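import Literature.MathematicalPhysics.QuantumLattice.HubbardTPPObjectMCapBoxWords
import HarnessLib

/-!
# Object-M words on `(U, t', t'', n)` boxes, vector shape: `Set.Icc` over `Fin 4 → ℝ`

Topic `MathematicalPhysics/QuantumLattice`, family `hubbard`. Companion of `HubbardTPPObjectMCapBoxWords`
(scalar letters). The downfold seam reads four-coordinate words in the shape
`∀ θ ∈ Set.Icc lo hi, W θ` with `θ 0 = U/t`, `θ 1 = t'/t`, `θ 2 = t''/t`, `θ 3 = n` (its `s2Coords₄` order);
this file is the bookkeeping between the scalar-letter box statements of the cap-word device and that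
vector shape: `mem_Icc_vec4_iff`, `forall_mem_Icc_vec4_of_forall₄`, `forall₄_of_forall_mem_Icc_vec4`, and
the object-M word in vector shape `tpp_word_Icc₄_of_forall₄`. Everything is proved; no definition.

## References

* A. Neumaier, Acta Numerica 13 (2004), §11 (box enclosures, coordinatewise bookkeeping).
  [cite: Neumaier2004CompleteSearch, §11]
* D. Ruelle, *Statistical Mechanics: Rigorous Results* (1969), §3.4. [cite: Ruelle1969, §3.4]
-/

namespace Literature.MathematicalPhysics.QuantumLattice

open Set

/-- Membership in a box of `Fin 4 → ℝ` with literal corners, coordinatewise.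
[cite: Neumaier2004CompleteSearch, §11] -/
theorem mem_Icc_vec4_iff {a₀ a₁ a₂ a₃ b₀ b₁ b₂ b₃ : ℝ} {θ : Fin 4 → ℝ} :
    θ ∈ Set.Icc (![a₀, a₁, a₂, a₃] : Fin 4 → ℝ) ![b₀, b₁, b₂, b₃] ↔
      (a₀ ≤ θ 0 ∧ θ 0 ≤ b₀) ∧ (a₁ ≤ θ 1 ∧ θ 1 ≤ b₁) ∧ (a₂ ≤ θ 2 ∧ θ 2 ≤ b₂) ∧ (a₃ ≤ θ 3 ∧ θ 3 ≤ b₃) := by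
  constructor
  · rintro ⟨h1, h2⟩
    exact ⟨⟨by simpa using h1 0, by simpa using h2 0⟩, ⟨by simpa using h1 1, by simpa using h2 1⟩,
      ⟨by simpa using h1 2, by simpa using h2 2⟩, ⟨by simpa using h1 3, by simpa using h2 3⟩⟩
  · rintro ⟨⟨h1, h2⟩, ⟨h3, h4⟩, ⟨h5, h6⟩, ⟨h7, h8⟩⟩
    refine ⟨fun k => ?_, fun k => ?_⟩ <;> fin_cases k <;> simp [h1, h2, h3, h4, h5, h6, h7, h8]

/-- **Scalar letters ⇒ vector box** (`θ 0 = u`, `θ 1 = s`, `θ 2 = r`, `θ 3 = n`): a statement under the eight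
inequalities holds on `Set.Icc ![U₁, s₁, r₁, n₁] ![U₂, s₂, r₂, n₂]`. [cite: Neumaier2004CompleteSearch, §11] -/
theorem forall_mem_Icc_vec4_of_forall₄ {P : ℝ → ℝ → ℝ → ℝ → Prop} {U₁ U₂ s₁ s₂ r₁ r₂ n₁ n₂ : ℝ}
    (h : ∀ u s r n : ℝ, U₁ ≤ u → u ≤ U₂ → s₁ ≤ s → s ≤ s₂ → r₁ ≤ r → r ≤ r₂ → n₁ ≤ n → n ≤ n₂ → P u s r n) :
    ∀ θ ∈ Set.Icc (![U₁, s₁, r₁, n₁] : Fin 4 → ℝ) ![U₂, s₂, r₂, n₂], P (θ 0) (θ 1) (θ 2) (θ 3) := by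
  intro θ hθ
  obtain ⟨⟨h1, h2⟩, ⟨h3, h4⟩, ⟨h5, h6⟩, ⟨h7, h8⟩⟩ := mem_Icc_vec4_iff.1 hθ
  exact h _ _ _ _ h1 h2 h3 h4 h5 h6 h7 h8

/-- **Vector box ⇒ scalar letters.** [cite: Neumaier2004CompleteSearch, §11] -/
theorem forall₄_of_forall_mem_Icc_vec4 {P : ℝ → ℝ → ℝ → ℝ → Prop} {U₁ U₂ s₁ s₂ r₁ r₂ n₁ n₂ : ℝ}
    (h : ∀ θ ∈ Set.Icc (![U₁, s₁, r₁, n₁] : Fin 4 → ℝ) ![U₂, s₂, r₂, n₂], P (θ 0) (θ 1) (θ 2) (θ 3)) :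
    ∀ u s r n : ℝ, U₁ ≤ u → u ≤ U₂ → s₁ ≤ s → s ≤ s₂ → r₁ ≤ r → r ≤ r₂ → n₁ ≤ n → n ≤ n₂ → P u s r n := by
  intro u s r n h1 h2 h3 h4 h5 h6 h7 h8
  have hθ := h ![u, s, r, n] (mem_Icc_vec4_iff.2 ⟨⟨h1, h2⟩, ⟨h3, h4⟩, ⟨h5, h6⟩, ⟨h7, h8⟩⟩)
  simpa using hθ

/-- Shrinking the vector box preserves a box statement. [cite: Neumaier2004CompleteSearch, §11] -/
theorem forall_mem_Icc_vec4_mono {P : (Fin 4 → ℝ) → Prop} {a₀ a₁ a₂ a₃ b₀ b₁ b₂ b₃ a₀' a₁' a₂' a₃' b₀' b₁' b₂' b₃' : ℝ}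
    (h : ∀ θ ∈ Set.Icc (![a₀, a₁, a₂, a₃] : Fin 4 → ℝ) ![b₀, b₁, b₂, b₃], P θ)
    (h₀ : a₀ ≤ a₀') (h₁ : a₁ ≤ a₁') (h₂ : a₂ ≤ a₂') (h₃ : a₃ ≤ a₃')
    (h₀' : b₀' ≤ b₀) (h₁' : b₁' ≤ b₁) (h₂' : b₂' ≤ b₂) (h₃' : b₃' ≤ b₃) :
    ∀ θ ∈ Set.Icc (![a₀', a₁', a₂', a₃'] : Fin 4 → ℝ) ![b₀', b₁', b₂', b₃'], P θ := by
  intro θ hθ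
  obtain ⟨⟨k1, k2⟩, ⟨k3, k4⟩, ⟨k5, k6⟩, ⟨k7, k8⟩⟩ := mem_Icc_vec4_iff.1 hθ
  exact h θ (mem_Icc_vec4_iff.2 ⟨⟨h₀.trans k1, k2.trans h₀'⟩, ⟨h₁.trans k3, k4.trans h₁'⟩,
    ⟨h₂.trans k5, k6.trans h₂'⟩, ⟨h₃.trans k7, k8.trans h₃'⟩⟩)

/-- **The object-M word in the seam's vector shape.** A two-sided word in scalar letters on the 4-box
becomes `∀ θ ∈ Set.Icc ![U₁, s₁, r₁, n₁] ![U₂, s₂, r₂, n₂], L ≤ e^M(1, θ 1, θ 2, θ 0; θ 3) ∧ e^M(…) ≤ R`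
(`θ = (U/t, t'/t, t''/t, n)`, the downfold `s2Coords₄` order). [cite: Ruelle1969, §3.4] -/
theorem tpp_word_Icc₄_of_forall₄ {U₁ U₂ s₁ s₂ r₁ r₂ n₁ n₂ L R : ℝ}
    (h : ∀ u s r n : ℝ, U₁ ≤ u → u ≤ U₂ → s₁ ≤ s → s ≤ s₂ → r₁ ≤ r → r ≤ r₂ → n₁ ≤ n → n ≤ n₂ →
      L ≤ (hubbardTT'T''FermionInteraction 1 s r u).tiGroundEnergyDensityAt 2 n ∧
        (hubbardTT'T''FermionInteraction 1 s r u).tiGroundEnergyDensityAt 2 n ≤ R) :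
    ∀ θ ∈ Set.Icc (![U₁, s₁, r₁, n₁] : Fin 4 → ℝ) ![U₂, s₂, r₂, n₂],
      L ≤ (hubbardTT'T''FermionInteraction 1 (θ 1) (θ 2) (θ 0)).tiGroundEnergyDensityAt 2 (θ 3) ∧
        (hubbardTT'T''FermionInteraction 1 (θ 1) (θ 2) (θ 0)).tiGroundEnergyDensityAt 2 (θ 3) ≤ R :=
  forall_mem_Icc_vec4_of_forall₄
    (P := fun u s r n => L ≤ (hubbardTT'T''FermionInteraction 1 s r u).tiGroundEnergyDensityAt 2 n ∧
      (hubbardTT'T''FermionInteraction 1 s r u).tiGroundEnergyDensityAt 2 n ≤ R) h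

/-- **One-sided (cap) version in vector shape.** [cite: Ruelle1969, §3.4] -/
theorem tpp_cap_Icc₄_of_forall₄ {U₁ U₂ s₁ s₂ r₁ r₂ n₁ n₂ R : ℝ}
    (h : ∀ u s r n : ℝ, U₁ ≤ u → u ≤ U₂ → s₁ ≤ s → s ≤ s₂ → r₁ ≤ r → r ≤ r₂ → n₁ ≤ n → n ≤ n₂ →
      (hubbardTT'T''FermionInteraction 1 s r u).tiGroundEnergyDensityAt 2 n ≤ R) :
    ∀ θ ∈ Set.Icc (![U₁, s₁, r₁, n₁] : Fin 4 → ℝ) ![U₂, s₂, r₂, n₂],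
      (hubbardTT'T''FermionInteraction 1 (θ 1) (θ 2) (θ 0)).tiGroundEnergyDensityAt 2 (θ 3) ≤ R :=
  forall_mem_Icc_vec4_of_forall₄
    (P := fun u s r n => (hubbardTT'T''FermionInteraction 1 s r u).tiGroundEnergyDensityAt 2 n ≤ R) h

end Literature.MathematicalPhysics.QuantumLattice
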